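import Summits.CriticalPhenomena.SAWScalingLimit.Theorems.SAWDevelopingMapNoFoldBoundPeelRowSupport

/-!
# The core of a generated equality row: from the dart expansion to a real inequality

Helper file for the crux `NoFoldBound` (stmt-CriticalPhenomena-8296) of the route `SAWDevelopingMap`
(sub-problem `SAWScalingLimit` of `CriticalPhenomena`), programme FLAT / PEELED LP of the lead seats
c9–c10 (`FLAT-LEAN-DESIGN.md` on the item, layer L3 generic brick G5). After the generator has expanded
the Duminil-Copin–Smirnov identity of a K-door `{p, q}` of `D = stripDom T L ∖ K` into

  `−κ/2 + Σᵢ κ/2 · e^{i(3/8)(π/3)nᵢ} · mᵢ + FAR = 0`,   `κ = c q − c p`,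

(door term `Peel.door_dart_term_eq`, local terms `Peel.local_term_eq` with the witness windings
`(π/3)·nᵢ` and the real masses `mᵢ` — unknown exit masses or the constant `x_c` of an immediate
exit — and the far part `FAR` signed by `Peel.re_far_sum_nonneg`), the row of the linear programme
used by the certificate is the real inequality

  `Σᵢ (u.re · cos(nᵢπ/8) + u.im · sin(nᵢπ/8)) · mᵢ ≤ u.re`

for the row's complex multiplier `u`. `row_core` performs this last, purely algebraic step once and
for all (multiply by `ū · 2/κ`, take real parts, `QT.exp_row_phase`), with the trigonometric values
as elements of `ℚ(t)` (`QT.cosTab`, `QT.sinTab`).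
-/

noncomputable section

open scoped BigOperators Classical ComplexConjugate

namespace Summit.CriticalPhenomena.SAWScalingLimit.Theorems.SAWDevelopingMapNoFoldBound.Peel

/-- The real coefficient of a local term with winding index `n` against the multiplier `u`. -/
theorem rowCoeff_def (u : ℂ) (n : ℤ) :
    u.re * QT.eval (Real.sqrt (2 + Real.sqrt 2)) (QT.cosTab (n % 16).toNat) +
      u.im * QT.eval (Real.sqrt (2 + Real.sqrt 2)) (QT.sinTab (n % 16).toNat) =
    (conj u * Complex.exp (Complex.I * (3 / 8 : ℝ) * (((Real.pi / 3 * n : ℝ)) : ℂ))).re := by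
  have := re_conj_mul_rowPhase_mul u n 1
  simp only [Complex.ofReal_one, mul_one] at this
  rw [this]

/-- Distributing `Re(c · Σ)` over a list of local terms. -/
theorem re_mul_list_sum (c : ℂ) : ∀ (l : List ℂ), (c * l.sum).re = (l.map fun z => (c * z).re).sum
  | [] => by simp
  | z :: l => by rw [List.sum_cons, mul_add, Complex.add_re, re_mul_list_sum c l, List.map_cons, List.sum_cons]

/-- **Row core.** From the expanded identity `−κ/2 + Σᵢ κ/2·phaseᵢ·mᵢ + FAR = 0` with `κ ≠ 0` and a far
part of signed real part `0 ≤ Re(ū·(2/κ)·FAR)`, the real row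
`Σᵢ (u.re cos(nᵢπ/8) + u.im sin(nᵢπ/8)) mᵢ ≤ u.re`. -/
theorem row_core : ∀ (u κ FAR : ℂ) (terms : List (ℤ × ℝ)), κ ≠ 0 → 0 ≤ (conj u * ((2 / κ) * FAR)).re → -(κ / 2) + (terms.map fun t => κ / 2 * (Complex.exp (Complex.I * (3 / 8 : ℝ) * (((Real.pi / 3 * t.1 : ℝ)) : ℂ)) * (t.2 : ℂ))).sum + FAR = 0 → (terms.map fun t => (u.re * QT.eval (Real.sqrt (2 + Real.sqrt 2)) (QT.cosTab (t.1 % 16).toNat) + u.im * QT.eval (Real.sqrt (2 + Real.sqrt 2)) (QT.sinTab (t.1 % 16).toNat)) * t.2).sum ≤ u.re := by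
  intro u κ FAR terms hκ hfar h0
  -- multiply by `ū · 2/κ` and take real parts
  have h1 := congrArg (fun z : ℂ => (conj u * ((2 / κ) * z)).re) h0
  simp only [mul_zero, Complex.zero_re, mul_add, Complex.add_re] at h1
  -- the door term
  have hdoor : (conj u * (2 / κ * -(κ / 2))).re = -u.re := by
    have : (2 / κ * -(κ / 2) : ℂ) = -1 := by field_simp
    rw [this]; simp
  -- the local terms
  have hloc : (conj u * (2 / κ * (terms.map fun t => κ / 2 *
      (Complex.exp (Complex.I * (3 / 8 : ℝ) * (((Real.pi / 3 * t.1 : ℝ)) : ℂ)) * (t.2 : ℂ))).sum)).re =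
      (terms.map fun t => (u.re * QT.eval (Real.sqrt (2 + Real.sqrt 2)) (QT.cosTab (t.1 % 16).toNat) +
        u.im * QT.eval (Real.sqrt (2 + Real.sqrt 2)) (QT.sinTab (t.1 % 16).toNat)) * t.2).sum := by
    rw [← mul_assoc, re_mul_list_sum, List.map_map]
    congr 1
    refine List.map_congr_left fun t _ => ?_
    simp only [Function.comp_apply]
    have e : conj u * (2 / κ) * (κ / 2 * (Complex.exp (Complex.I * (3 / 8 : ℝ) *
        (((Real.pi / 3 * t.1 : ℝ)) : ℂ)) * (t.2 : ℂ))) =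
        conj u * (Complex.exp (Complex.I * (3 / 8 : ℝ) * (((Real.pi / 3 * t.1 : ℝ)) : ℂ)) * (t.2 : ℂ)) := by
      field_simp
    rw [e, re_conj_mul_rowPhase_mul]
  rw [hdoor, hloc] at h1
  linarith

end Summit.CriticalPhenomena.SAWScalingLimit.Theorems.SAWDevelopingMapNoFoldBound.Peel
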